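import Summits.CriticalPhenomena.PercolationContinuityZ3.Theorems.PercShatteringRaceNearLinearTwoClusterDecayPairDecayNullWorld
import Summits.CriticalPhenomena.PercolationContinuityZ3.Theorems.PercShatteringRaceNearLinearTwoClusterDecaySplit
import Literature.Probability.Percolation.SeedLemma
import HarnessLib

/-!
# Crux `PercShatteringRace.NearLinearTwoClusterDecay` (stmt-CriticalPhenomena-5785) — child 2 in the orthodox world

Helper file of the lead (seat c4) of the line `pair-decay-long-arms-dense`; lands with
`--supports stmt-CriticalPhenomena-5785` (registered certificate stub
`longArmsAreDense_iff_crossingDecay_of_theta_eq_zero` of skeleton rev L1-c4).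

**World profile of child 2.**  In the orthodox world `θ(p_c) = 0` the proposed sub-crux
`LongArmsAreDense` ("w.h.p. no `x ∈ Λ(n)` has an in-box arm to `∂ⁱⁿΛ(m)`, `m = ⌈n^{7/6}⌉`, whose
`Λ(m)`-cluster has a `κ`-thin trace in `Λ(n)`") is EXACTLY polynomial-aspect in-box crossing decay at
aspect `7/6` ("`P_{p_c}(Λ(n) ↔ ∂ⁱⁿΛ(⌈n^{7/6}⌉) inside the box) → 0`"; the crossing event is written
`{ω | ∃ x ∈ Λ(n), ω ∈ reachesOut m x}` in the vocabulary of the split core).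

* (⇐) a thin arm is in particular a crossing (`κ = 1`).
* (⇒) deterministic dichotomy: a crossing from `x ∈ Λ(n)` either has a `κ`-thin trace, or its trace —
  every point of which is itself an ARM POINT (joined inside `Λ(m)` to `∂ⁱⁿΛ(m)`, by
  `GM.openConnIn_comm` / `GM.openConnIn_trans`) — has `≥ κ|Λ(n)|` points, so `Λ(n)` contains
  `≥ κ|Λ(n)|` arm points (`card_trace_le_sum_indicator_reachesOut`); Markov on the arm-point count
  (`real_sum_indicator_reachesOut_ge_le`, the pattern of `pairCountBound`) and the one-arm bound
  `P(z reaches ∂ⁱⁿΛ(m) in Λ(m)) ≤ P(0 ↔ ∂Λ_{m-n})` (`real_reachesOut_le_siteToBoundary`) give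
  `P(≥ κ|Λ(n)| arm points) ≤ κ⁻¹ P(0 ↔ ∂Λ_{m-n}) → κ⁻¹ θ(p_c) = 0` (`tendsto_real_siteToBoundary_outer_sub`).
Pure bookkeeping over landed lemmas; no new mathematics.
-/

noncomputable section

namespace Summit.CriticalPhenomena.PercolationContinuityZ3.Theorems

namespace NearLinearTwoClusterDecaySplit

open MeasureTheory Filter Topology
open Literature.Probability.LatticeModels Literature.Probability.Percolation
open Summit.CriticalPhenomena.PercolationContinuityZ3.Theses.PercShatteringRace

/-! ## Deterministic core: the trace of an arm consists of arm points -/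

/-- **Inheritance, counted**: if `x` reaches `∂ⁱⁿΛ(m)` inside `Λ(m)`, every point of the `Λ(n)`-trace of
its `Λ(m)`-cluster is an arm point, so `|trace| ≤ #{z ∈ Λ(n) : z reaches ∂ⁱⁿΛ(m) in Λ(m)}`
(the arm-point count written as an indicator sum). [folklore] -/
theorem card_trace_le_sum_indicator_reachesOut {n m : ℕ} {x : Site 3} {ω : BondConfig (Site 3)}
    (h : ω ∈ reachesOut m x) :
    ((trace n m ω x).card : ℝ) ≤
      ∑ z ∈ box 3 n, (reachesOut m z).indicator (1 : BondConfig (Site 3) → ℝ) ω := by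
  classical
  have hsub : trace n m ω x ⊆ (box 3 n).filter fun z => ω ∈ reachesOut m z := by
    intro z hz
    simp only [trace, Finset.mem_filter] at hz
    simp only [Finset.mem_filter]
    obtain ⟨y, hy, hxy⟩ := h
    exact ⟨hz.1, y, hy, GM.openConnIn_trans (GM.openConnIn_comm.1 hz.2) hxy⟩
  have hsum : (∑ z ∈ box 3 n, (reachesOut m z).indicator (1 : BondConfig (Site 3) → ℝ) ω) =
      ((box 3 n).filter fun z => ω ∈ reachesOut m z).card := by
    simp only [Finset.card_filter, Set.indicator_apply, Pi.one_apply, Nat.cast_sum, Nat.cast_ite,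
      Nat.cast_one, Nat.cast_zero]
  rw [hsum]
  exact_mod_cast Finset.card_le_card hsub

/-! ## Markov on the arm-point count (`ArmCountBound`) -/

/-- **`ArmCountBound`**: Markov on the arm-point count of `Λ(n)`,
`P(Σ_{z ∈ Λ(n)} 1[z reaches ∂ⁱⁿΛ(m) in Λ(m)] ≥ c) ≤ c⁻¹ Σ_{z ∈ Λ(n)} P(z reaches ∂ⁱⁿΛ(m) in Λ(m))`. [folklore] -/
theorem real_sum_indicator_reachesOut_ge_le (n m : ℕ) {c : ℝ} (hc : 0 < c) :
    Pc.real {ω | c ≤ ∑ z ∈ box 3 n, (reachesOut m z).indicator (1 : BondConfig (Site 3) → ℝ) ω} ≤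
      c⁻¹ * ∑ z ∈ box 3 n, Pc.real (reachesOut m z) := by
  have hint : ∀ z ∈ box 3 n,
      Integrable ((reachesOut m z).indicator (1 : BondConfig (Site 3) → ℝ)) Pc :=
    fun z _ => (integrable_const (1 : ℝ)).indicator (measurableSet_reachesOut m z)
  have hnn : 0 ≤ᵐ[Pc] fun ω => ∑ z ∈ box 3 n, (reachesOut m z).indicator (1 : BondConfig (Site 3) → ℝ) ω :=
    Eventually.of_forall fun ω => Finset.sum_nonneg fun z _ =>
      Set.indicator_nonneg (fun _ _ => zero_le_one) ω
  have hmarkov := mul_meas_ge_le_integral_of_nonneg hnn (integrable_finsetSum _ hint) c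
  have hI : ∫ ω, (∑ z ∈ box 3 n, (reachesOut m z).indicator (1 : BondConfig (Site 3) → ℝ) ω) ∂Pc =
      ∑ z ∈ box 3 n, Pc.real (reachesOut m z) := by
    rw [integral_finsetSum _ hint]
    exact Finset.sum_congr rfl fun z _ => integral_indicator_one (measurableSet_reachesOut m z)
  rw [hI] at hmarkov
  rw [← div_eq_inv_mul, le_div_iff₀ hc, mul_comm]
  exact hmarkov

/-! ## The two directions in the file-local vocabulary -/

/-- (⇒), quantitative: in the orthodox world, child 2 gives eventually
`P(Λ(n) ↔ ∂ⁱⁿΛ(⌈n^{7/6}⌉) in the box) ≤ 2ε` (dichotomy thin trace / `≥ κ|Λ(n)|` arm points, Markov,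
one-arm bound across the gap `⌈n^{7/6}⌉ - n`, `P(0 ↔ ∂Λ_k) → θ(p_c) = 0`). [folklore] -/
theorem eventually_real_cross_le (hθ : theta (zdGraph 3) 0 (criticalProbI 3) = 0)
    (h2 : ∀ ε : ℝ, 0 < ε → ∃ κ : ℝ, 0 < κ ∧ ∀ᶠ n : ℕ in atTop, Pc.real (thinEvt n (outer n) κ) ≤ ε)
    {ε : ℝ} (hε : 0 < ε) :
    ∀ᶠ n : ℕ in atTop, Pc.real {ω | ∃ x ∈ box 3 n, ω ∈ reachesOut (outer n) x} ≤ 2 * ε := by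
  obtain ⟨κ, hκ, hthin⟩ := h2 ε hε
  have ht := tendsto_real_siteToBoundary_outer_sub (criticalProbI 3)
  rw [hθ] at ht
  have hεκ : 0 < ε * κ := by positivity
  filter_upwards [hthin, (tendsto_order.1 ht).2 (ε * κ) hεκ] with n hn2 hn1
  have hc : 0 < ((box 3 n).card : ℝ) := by exact_mod_cast Finset.card_pos.2 ⟨0, zero_mem_box 3 n⟩
  have hK : 0 < κ * (box 3 n).card := by positivity
  have hle : n ≤ outer n := le_nat_ceil_rpow (by norm_num : (1 : ℝ) ≤ 7 / 6) n
  have hsub : {ω | ∃ x ∈ box 3 n, ω ∈ reachesOut (outer n) x} ⊆ thinEvt n (outer n) κ ∪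
      {ω | κ * (box 3 n).card ≤
        ∑ z ∈ box 3 n, (reachesOut (outer n) z).indicator (1 : BondConfig (Site 3) → ℝ) ω} := by
    rintro ω ⟨x, hx, hreach⟩
    by_cases h1 : ((trace n (outer n) ω x).card : ℝ) < κ * (box 3 n).card
    · exact Or.inl ⟨x, hx, hreach, h1⟩
    · exact Or.inr ((not_lt.1 h1).trans (card_trace_le_sum_indicator_reachesOut hreach))
  calc Pc.real {ω | ∃ x ∈ box 3 n, ω ∈ reachesOut (outer n) x}
      ≤ Pc.real (thinEvt n (outer n) κ ∪ {ω | κ * (box 3 n).card ≤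
          ∑ z ∈ box 3 n, (reachesOut (outer n) z).indicator (1 : BondConfig (Site 3) → ℝ) ω}) :=
        measureReal_mono hsub
    _ ≤ Pc.real (thinEvt n (outer n) κ) + Pc.real {ω | κ * (box 3 n).card ≤
          ∑ z ∈ box 3 n, (reachesOut (outer n) z).indicator (1 : BondConfig (Site 3) → ℝ) ω} :=
        measureReal_union_le _ _
    _ ≤ ε + (κ * (box 3 n).card)⁻¹ * ∑ z ∈ box 3 n, Pc.real (reachesOut (outer n) z) :=
        add_le_add hn2 (real_sum_indicator_reachesOut_ge_le n (outer n) hK)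
    _ ≤ ε + (κ * (box 3 n).card)⁻¹ * ∑ z ∈ box 3 n, ε * κ := by
        refine add_le_add le_rfl
          (mul_le_mul_of_nonneg_left (Finset.sum_le_sum fun z hz => ?_) (by positivity))
        exact (real_reachesOut_le_siteToBoundary (criticalProbI 3) hle hz).trans hn1.le
    _ = 2 * ε := by
        rw [Finset.sum_const, nsmul_eq_mul]
        field_simp
        ring

/-- (⇒): in the orthodox world, child 2 implies in-box crossing decay at aspect `7/6`. [folklore] -/
theorem tendsto_real_cross_of_longArmsDense' (hθ : theta (zdGraph 3) 0 (criticalProbI 3) = 0)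
    (h2 : ∀ ε : ℝ, 0 < ε → ∃ κ : ℝ, 0 < κ ∧ ∀ᶠ n : ℕ in atTop, Pc.real (thinEvt n (outer n) κ) ≤ ε) :
    Tendsto (fun n : ℕ => Pc.real {ω | ∃ x ∈ box 3 n, ω ∈ reachesOut (outer n) x}) atTop (𝓝 0) := by
  refine Metric.tendsto_atTop.2 fun ε hε => ?_
  obtain ⟨N, hN⟩ := (eventually_real_cross_le hθ h2 (half_pos (half_pos hε))).exists_forall_of_atTop
  refine ⟨N, fun n hn => ?_⟩
  rw [Real.dist_eq, sub_zero, abs_of_nonneg measureReal_nonneg]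
  have := hN n hn
  linarith

/-- (⇐): in-box crossing decay implies child 2 (with `κ = 1`; a thin arm is a crossing), in every world. [folklore] -/
theorem longArmsDense'_of_tendsto_real_cross
    (h : Tendsto (fun n : ℕ => Pc.real {ω | ∃ x ∈ box 3 n, ω ∈ reachesOut (outer n) x}) atTop (𝓝 0)) :
    ∀ ε : ℝ, 0 < ε → ∃ κ : ℝ, 0 < κ ∧ ∀ᶠ n : ℕ in atTop, Pc.real (thinEvt n (outer n) κ) ≤ ε := by
  intro ε hε
  refine ⟨1, one_pos, ?_⟩
  have hev : ∀ᶠ n : ℕ in atTop, Pc.real {ω | ∃ x ∈ box 3 n, ω ∈ reachesOut (outer n) x} < ε :=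
    (tendsto_order.1 h).2 ε hε
  filter_upwards [hev] with n hn
  refine le_trans (measureReal_mono ?_) hn.le
  rintro ω ⟨x, hx, hreach, -⟩
  exact ⟨x, hx, hreach⟩

/-- **World profile of child 2, file-local vocabulary**: if `θ(p_c) = 0` then
`LongArmsAreDense ↔ (P(Λ(n) ↔ ∂ⁱⁿΛ(⌈n^{7/6}⌉) in the box) → 0)`. [folklore] -/
theorem longArmsDense'_iff_tendsto_real_cross (hθ : theta (zdGraph 3) 0 (criticalProbI 3) = 0) :
    (∀ ε : ℝ, 0 < ε → ∃ κ : ℝ, 0 < κ ∧ ∀ᶠ n : ℕ in atTop, Pc.real (thinEvt n (outer n) κ) ≤ ε) ↔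
    Tendsto (fun n : ℕ => Pc.real {ω | ∃ x ∈ box 3 n, ω ∈ reachesOut (outer n) x}) atTop (𝓝 0) :=
  ⟨tendsto_real_cross_of_longArmsDense' hθ, longArmsDense'_of_tendsto_real_cross⟩

/-- The crossing event at the crux radii, written out (the route wording). [folklore] -/
theorem setOf_exists_reachesOut_outer_eq (n : ℕ) : {ω | ∃ x ∈ box 3 n, ω ∈ reachesOut (outer n) x} =
    {ω : BondConfig (Site 3) | ∃ x ∈ box 3 n,
      ∃ y ∈ innerBoundary (zdGraph 3) (box 3 ⌈(n : ℝ) ^ ((7 : ℝ) / 6)⌉₊),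
        ω ∈ openConnIn ↑(box 3 ⌈(n : ℝ) ^ ((7 : ℝ) / 6)⌉₊) x y} := by
  ext ω
  simp only [reachesOut, outer, Set.mem_setOf_eq]

end NearLinearTwoClusterDecaySplit

open MeasureTheory Filter Topology
open Literature.Probability.LatticeModels Literature.Probability.Percolation
open Summit.CriticalPhenomena.PercolationContinuityZ3.Theses.PercShatteringRace
open NearLinearTwoClusterDecaySplit

/-- **Certificate stub `longArmsAreDense_iff_crossingDecay_of_theta_eq_zero` of the line
`pair-decay-long-arms-dense`** (registered): in the orthodox world `θ(p_c) = 0`, the proposed sub-crux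
`LongArmsAreDense` (child 2 of `U(1/6)`: w.h.p. no `x ∈ Λ(n)` has an in-box arm to `∂ⁱⁿΛ(⌈n^{7/6}⌉)`
while its `Λ(⌈n^{7/6}⌉)`-cluster has a `κ`-thin trace in `Λ(n)`) is EQUIVALENT to in-box crossing decay
at aspect `7/6` (`P_{p_c}(Λ(n) ↔ ∂ⁱⁿΛ(⌈n^{7/6}⌉) inside the box) → 0`).  (⇐) a thin arm is a crossing;
(⇒) a crossing has a thin trace or `≥ κ|Λ(n)|` arm points, and Markov on the arm-point count with the
one-arm bound gives `≤ κ⁻¹ P(0 ↔ ∂Λ_{⌈n^{7/6}⌉-n}) → κ⁻¹ θ(p_c) = 0`. [folklore] -/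
theorem longArmsAreDense_iff_crossingDecay_of_theta_eq_zero
    (hθ : theta (zdGraph 3) 0 (criticalProbI 3) = 0) :
    (∀ ε : ℝ, 0 < ε → ∃ κ : ℝ, 0 < κ ∧ ∀ᶠ n : ℕ in Filter.atTop,
      (bondPercolation (zdGraph 3) (criticalProbI 3)).real
        {ω | ∃ x ∈ box 3 n,
          (∃ y ∈ innerBoundary (zdGraph 3) (box 3 ⌈(n : ℝ) ^ ((7 : ℝ) / 6)⌉₊),
            ω ∈ openConnIn ↑(box 3 ⌈(n : ℝ) ^ ((7 : ℝ) / 6)⌉₊) x y) ∧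
          (Set.ncard {z : Site 3 | z ∈ box 3 n ∧
              ω ∈ openConnIn ↑(box 3 ⌈(n : ℝ) ^ ((7 : ℝ) / 6)⌉₊) x z} : ℝ) < κ * (box 3 n).card} ≤ ε) ↔
    Filter.Tendsto (fun n : ℕ => (bondPercolation (zdGraph 3) (criticalProbI 3)).real
      {ω | ∃ x ∈ box 3 n, ∃ y ∈ innerBoundary (zdGraph 3) (box 3 ⌈(n : ℝ) ^ ((7 : ℝ) / 6)⌉₊),
        ω ∈ openConnIn ↑(box 3 ⌈(n : ℝ) ^ ((7 : ℝ) / 6)⌉₊) x y}) Filter.atTop (nhds 0) := by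
  have e : (∀ ε : ℝ, 0 < ε → ∃ κ : ℝ, 0 < κ ∧ ∀ᶠ n : ℕ in Filter.atTop,
      (bondPercolation (zdGraph 3) (criticalProbI 3)).real
        {ω | ∃ x ∈ box 3 n,
          (∃ y ∈ innerBoundary (zdGraph 3) (box 3 ⌈(n : ℝ) ^ ((7 : ℝ) / 6)⌉₊),
            ω ∈ openConnIn ↑(box 3 ⌈(n : ℝ) ^ ((7 : ℝ) / 6)⌉₊) x y) ∧
          (Set.ncard {z : Site 3 | z ∈ box 3 n ∧
              ω ∈ openConnIn ↑(box 3 ⌈(n : ℝ) ^ ((7 : ℝ) / 6)⌉₊) x z} : ℝ) < κ * (box 3 n).card} ≤ ε) ↔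
      ∀ ε : ℝ, 0 < ε → ∃ κ : ℝ, 0 < κ ∧ ∀ᶠ n : ℕ in atTop, Pc.real (thinEvt n (outer n) κ) ≤ ε := by
    simp only [thinEvt_eq]
  have e' : (fun n : ℕ => (bondPercolation (zdGraph 3) (criticalProbI 3)).real
      {ω | ∃ x ∈ box 3 n, ∃ y ∈ innerBoundary (zdGraph 3) (box 3 ⌈(n : ℝ) ^ ((7 : ℝ) / 6)⌉₊),
        ω ∈ openConnIn ↑(box 3 ⌈(n : ℝ) ^ ((7 : ℝ) / 6)⌉₊) x y}) =
      fun n : ℕ => Pc.real {ω | ∃ x ∈ box 3 n, ω ∈ reachesOut (outer n) x} := by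
    funext n
    rw [setOf_exists_reachesOut_outer_eq]
  rw [e, e']
  exact longArmsDense'_iff_tendsto_real_cross hθ

end Summit.CriticalPhenomena.PercolationContinuityZ3.Theorems
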